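import Summits.Ventures.PercRepro.RankLevelSetExplicitLin2Cells

/-!
# PercRepro — THE CELL MAP AT CORANK `q + 1` (p9, S4)

`proofs/SUBCLAIM-S4-p9.md` §S4.3⁗. The cell map `c025_core_cell_lin2` starts at corank `d ≥ q + 2` (its regime-I′
budget `8 + (1/8 + 13/3 + 1/2)·2^{d−q} ≤ 7·2^{d−q}` needs `d ≥ q + 2`). At corank `d = q + 1` the same term bounds
hold with room to spare — the `(S5)` term is `≤ 11·d·C(p+q, q)` instead of `35·d·C(p+q, q)`, because `k⁴ ≥ (d+2)² ≥ d²`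
and `10(q+1) ≤ 2^q` — and the assembled inequality closes with the budget `8 + (1/8 + 7/3 + 1/2)·2 ≤ 14`
(`poly_cells_succ`). Hence the `e`-free core cell of corank `q + 1` closes for `p ≥ Tcell2 q (q+1) k` as well
(`c025_core_cell_succ_lin2`), and the open band of every window is ONE interval of coranks. Axioms: standard.
-/

open scoped Matroid

namespace PercRepro

namespace ThmN

namespace Explicit

/-- `10(q+1) ≤ 2^q` for `q ≥ 8`. -/
theorem ten_mul_succ_le_two_pow (q : ℕ) (hq : 8 ≤ q) : 10 * (q + 1) ≤ 2 ^ q := by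
  induction q, hq using Nat.le_induction with
  | base => norm_num
  | succ q hq ih =>
    rw [pow_succ]
    omega

/-- **(S5) at corank `q + 1`**: `96·2^q·C(2d+2q−2, 4)·C(2d+2q−6+(p+d), q−4) ≤ 11·d·C(p+q, q)` for `d = q + 1`. -/
theorem small_five_succ (q d p k : ℕ) (hd : d = q + 1) (hq : 8 ≤ q) (h2 : 3 * (q + 5) * d ≤ p)
    (hk : d + 2 ≤ k ^ 2) (hk3 : 3 * k ^ 2 ≤ 2 ^ q) (h3 : 3 * q * k * 2 ^ ((q + 1) / 2) ≤ p) :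
    96 * 2 ^ q * (2 * d + 2 * q - 2).choose 4 * (2 * d + 2 * q - 6 + (p + d)).choose (q - 4) ≤
      11 * d * (p + q).choose q := by
  obtain ⟨-, -, h8, h4⟩ := cell_ratios q d p hq (by omega) h2
  obtain ⟨-, -, hdown⟩ := levels_down2 p q (by omega)
  obtain ⟨-, -, hp4⟩ := cell_powers q k p h3 hk3
  have h10 := ten_mul_succ_le_two_pow q hq
  have hkey : 196608 * 2 ^ q * d ^ 4 * q ^ 4 ≤ 264 * d * p ^ 4 := by
    have h1 : d ^ 2 ≤ k ^ 4 := by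
      calc d ^ 2 ≤ (k ^ 2) ^ 2 := Nat.pow_le_pow_left (by omega) 2
        _ = k ^ 4 := by ring
    have hdq : 196608 * d ≤ 21384 * 2 ^ q := by
      calc 196608 * d = 196608 * (q + 1) := by rw [hd]
        _ ≤ 21384 * (10 * (q + 1)) := by omega
        _ ≤ 21384 * 2 ^ q := Nat.mul_le_mul_left _ h10
    calc 196608 * 2 ^ q * d ^ 4 * q ^ 4 = d * ((196608 * d) * d ^ 2 * (2 ^ q * q ^ 4)) := by ring
      _ ≤ d * ((21384 * 2 ^ q) * k ^ 4 * (2 ^ q * q ^ 4)) := by gcongr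
      _ = 264 * d * (81 * q ^ 4 * k ^ 4 * (2 ^ q) ^ 2) := by ring
      _ ≤ 264 * d * p ^ 4 := Nat.mul_le_mul_left _ hp4
  have hp0 : 0 < p := lt_of_lt_of_le (Nat.mul_pos (Nat.mul_pos (by norm_num) (by omega)) (by omega)) h2
  have hpos : 0 < 24 * p ^ 4 := by have := pow_pos hp0 4; omega
  apply Nat.le_of_mul_le_mul_right _ hpos
  calc 96 * 2 ^ q * (2 * d + 2 * q - 2).choose 4 * (2 * d + 2 * q - 6 + (p + d)).choose (q - 4) * (24 * p ^ 4)
      = 96 * 2 ^ q * (24 * (2 * d + 2 * q - 2).choose 4) * (2 * d + 2 * q - 6 + (p + d)).choose (q - 4) * p ^ 4 := by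
        ring
    _ ≤ 96 * 2 ^ q * (256 * d ^ 4) * (8 * (p + q).choose (q - 4)) * p ^ 4 := by gcongr
    _ = 196608 * 2 ^ q * d ^ 4 * (p ^ 4 * (p + q).choose (q - 4)) := by ring
    _ ≤ 196608 * 2 ^ q * d ^ 4 * (q ^ 4 * (p + q).choose q) := Nat.mul_le_mul_left _ hdown
    _ = (196608 * 2 ^ q * d ^ 4 * q ^ 4) * (p + q).choose q := by ring
    _ ≤ (264 * d * p ^ 4) * (p + q).choose q := Nat.mul_le_mul_right _ hkey
    _ = 11 * d * (p + q).choose q * (24 * p ^ 4) := by ring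

/-- **THE ASSEMBLED `(P_d)` AT CORANK `d = q + 1`** (in `ℚ`): at level `q ≥ 8`, `p ≥ Tcell2 q d k`
(`d + 2 ≤ k²`, `3k² ≤ 2^q`), both weights at their cap (`W·d ≤ 2^d`):
`8·(C(p+d, q) + W_s·A + W_b·B) ≤ 7·2^{d−q}·C(p+q, q)` — the budget `8 + (1/8 + 7/3 + 1/2)·2 ≤ 14`. -/
theorem poly_cells_succ (q d p k : ℕ) (hd : d = q + 1) (hq : 8 ≤ q)
    (hk : d + 2 ≤ k ^ 2) (hk3 : 3 * k ^ 2 ≤ 2 ^ q) (hp : Tcell2 q d k ≤ p)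
    (A B : ℕ) (Ws Wb : ℚ) (hWs : Ws * d ≤ 2 ^ d) (hWb : Wb * d ≤ 2 ^ d)
    (hA : 6 * A ≤ 3 * (d * (d + 1)) * (p + d).choose (q - 2) + 2 * (d * (d + 1) * (d + 2)) * (p + d).choose (q - 3) +
      6 * ((2 * d + 2 * q - 2).choose 4 * (2 * d + 2 * q - 6 + (p + d)).choose (q - 4)))
    (hB : B ≤ ((q + 3) * d + 2 * q - 2).choose q) :
    8 * (((p + d).choose q : ℚ) + Ws * A + Wb * B) ≤ 7 * 2 ^ (d - q) * ((p + q).choose q : ℚ) := by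
  obtain ⟨h1, h2, h3, hp2⟩ := Tcell2_facts q d k p hp
  set C := (p + q).choose q with hC
  set A6 := 3 * (d * (d + 1)) * (p + d).choose (q - 2) + 2 * (d * (d + 1) * (d + 2)) * (p + d).choose (q - 3) +
      6 * ((2 * d + 2 * q - 2).choose 4 * (2 * d + 2 * q - 6 + (p + d)).choose (q - 4)) with hA6
  have hd0 : 0 < d := by omega
  have hdq : d - q = 1 := by omega
  have hC1 := c1_cell q d p hq (by omega) h1 h2
  have hC1q : 64 * ((p + d).choose q : ℚ) ≤ (64 + 2 ^ (d - q)) * (C : ℚ) := by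
    rw [hC]; exact_mod_cast hC1
  have hBn : 16 * 2 ^ q * B ≤ 1 * d * 2 ^ 0 * C :=
    (Nat.mul_le_mul_left _ hB).trans (by rw [one_mul, pow_zero, mul_one]; exact big_cell q d p hq (by omega) h2)
  have hbig := weight_bound2 q d d 0 16 1 B B C Wb hWb hd0 le_rfl hBn (by omega) (by omega)
  push_cast at hbig
  have hs3 := small_three_cell q d p k hq (by omega) h2 hk hp2
  have hs4 := small_four_cell q d p k hq (by omega) h2 hk hk3 h3
  have hs5 := small_five_succ q d p k hd hq h2 hk hk3 h3
  have hS : 4 * 2 ^ q * A6 ≤ 7 * d * 2 ^ 0 * C := by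
    rw [pow_zero, mul_one]
    have : 16 * 2 ^ q * A6 ≤ 28 * d * C := by
      calc 16 * 2 ^ q * A6 = 2 * (24 * 2 ^ q * (d * (d + 1)) * (p + d).choose (q - 2)) +
            32 * 2 ^ q * (d * (d + 1) * (d + 2)) * (p + d).choose (q - 3) +
            96 * 2 ^ q * (2 * d + 2 * q - 2).choose 4 * (2 * d + 2 * q - 6 + (p + d)).choose (q - 4) := by
            rw [hA6]; ring
        _ ≤ 2 * (7 * d * C) + 3 * d * C + 11 * d * C := by gcongr
        _ = 28 * d * C := by ring
    have h4 : 4 * (4 * 2 ^ q * A6) ≤ 4 * (7 * d * C) := by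
      calc 4 * (4 * 2 ^ q * A6) = 16 * 2 ^ q * A6 := by ring
        _ ≤ 28 * d * C := this
        _ = 4 * (7 * d * C) := by ring
    exact Nat.le_of_mul_le_mul_left h4 (by norm_num)
  have hsmall := weight_bound2 q d d 0 4 7 A6 (6 * A) C Ws hWs hd0 hA hS (by omega) (by omega)
  push_cast at hsmall
  have hC0 : (0 : ℚ) ≤ C := Nat.cast_nonneg _
  rw [hdq] at hC1q hbig hsmall ⊢
  norm_num at hC1q hbig hsmall ⊢
  nlinarith

end Explicit

variable {α : Type}

/-- **THE CELL MAP AT CORANK `q + 1`**: the `e`-free core at level `q ≥ 8`, rank `p ≥ Tcell2 q (q+1) k`, corank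
`q + 1` (`q + 3 ≤ k²`, `3k² ≤ 2^q`) satisfies `RLS M p q`. -/
theorem c025_core_cell_succ_lin2 (q : ℕ) (hq : 8 ≤ q) (M : Matroid α) [M.Finite] (p k : ℕ)
    (hk : q + 1 + 2 ≤ k ^ 2) (hk3 : 3 * k ^ 2 ≤ 2 ^ q) (hp : Explicit.Tcell2 q (q + 1) k ≤ p)
    (hR : M.eRank = (p : ℕ∞)) (hn : M.E.ncard = p + (q + 1))
    (hfree : ∀ e ∈ M.E, ∃ A ⊆ M.E \ {e}, e ∉ M.closure A ∧ e ∉ M.closure ((M.E \ {e}) \ A)) :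
    RLS M p q :=
  c025_core_cell_of_poly q hq M p (q + 1) le_rfl (Explicit.Tcell2_facts q (q + 1) k p hp).1
    (Explicit.Tcell2_facts q (q + 1) k p hp).2.1
    (fun A B W hW hA hB => Explicit.poly_cells_succ q (q + 1) p k rfl hq hk hk3 hp A B W W hW hW hA hB) hR hn hfree

/-- **THE CELL MAP FROM CORANK `q + 1` ON**: every `e`-free core cell of corank `q + 1 ≤ d` closes for
`p ≥ Tcell2 q d k`, `d + 2 ≤ k²`, `3k² ≤ 2^q` (`c025_core_cell_succ_lin2` at `d = q + 1`, `c025_core_cell_lin2`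
above). -/
theorem c025_core_cell_lin2' (q : ℕ) (hq : 8 ≤ q) (M : Matroid α) [M.Finite] (p d k : ℕ)
    (hd1 : q + 1 ≤ d) (hk : d + 2 ≤ k ^ 2) (hk3 : 3 * k ^ 2 ≤ 2 ^ q) (hp : Explicit.Tcell2 q d k ≤ p)
    (hR : M.eRank = (p : ℕ∞)) (hn : M.E.ncard = p + d)
    (hfree : ∀ e ∈ M.E, ∃ A ⊆ M.E \ {e}, e ∉ M.closure A ∧ e ∉ M.closure ((M.E \ {e}) \ A)) :
    RLS M p q := by
  rcases Nat.lt_or_ge d (q + 2) with h | h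
  · have hd : d = q + 1 := by omega
    subst hd
    exact c025_core_cell_succ_lin2 q hq M p k hk hk3 hp hR hn hfree
  · exact c025_core_cell_lin2 q hq M p d k h hk hk3 hp hR hn hfree

/-- Level `10`, corank `11` (`k = 4`): the core cell closes from `p = 3 840` (uniform: `20 480`). -/
theorem c025_core_cell_ten_eleven (M : Matroid α) [M.Finite] (p : ℕ) (hp : 3840 ≤ p)
    (hR : M.eRank = (p : ℕ∞)) (hn : M.E.ncard = p + 11)
    (hfree : ∀ e ∈ M.E, ∃ A ⊆ M.E \ {e}, e ∉ M.closure A ∧ e ∉ M.closure ((M.E \ {e}) \ A)) : RLS M p 10 :=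
  c025_core_cell_succ_lin2 10 (by norm_num) M p 4 (by norm_num) (by norm_num)
    (by unfold Explicit.Tcell2; norm_num; omega) hR hn hfree

end ThmN

end PercRepro
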